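import Literature.Probability.LatticeModels.MedialPolygonSimple
import Literature.Topology.PlaneTopology.TightPolyline
import HarnessLib

/-!
# Tight arcs of the perturbed medial polygon across an annulus, one per traversal

Topic `Literature/Probability/LatticeModels` (trunk `StatMech`, family `crit-ising`): the
deterministic input of Aizenman–Burchard's regularity criterion (Duke Math. J. 99 (1999),
Appendix A, Lemma A.5: "the `k` crossing segments cut the annulus into sectors") for the
FK-Ising exploration interface. For a medial exploration path (`IsMedialExploration D ω (a :: l)`,
any discrete Dobrushin domain `D`, mesh `δ = D.δ`) and one traversal of a shell `D(x; ρ, R)` by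
its medial polyline, we extract from the *perturbed* polygon (`pertTrace`, a simple curve by
`MedialPolygonSimple`) a **tight arc** `T` of the annulus `q₁ ≤ |z - x| ≤ q₂`: a path from the
inner to the outer circle inside the closed annulus meeting each circle only at the
corresponding endpoint, made of whole pieces of the polygon indexed inside the traversal
(`exists_traversal_arc`). With it come a dart `m` whose piece lies on `T` deep inside the
annulus, and a stretch of darts `i' ≤ m ≤ j'` whose left vertices have their
`4δ`-neighbourhoods in the open annulus and whose ends are near the circles of radii `r₁`,
`r₂` (the left chain of the sector). The pieces of the polygon are indexed globally
(`pieceSet (2i) = dartPiece i`, `pieceSet (2i+1) = connPiece (i+1)`), so that the arcs of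
different traversals are supported on separated index ranges, hence disjoint
(`MedialPolygonSimple`), and everything downstream is combinatorial. The analysis is in
`TightPolyline` (`exists_tight_polyline` / `'`).

## References

* M. Aizenman, A. Burchard, *Hölder regularity and dimension bounds for random curves*, Duke
  Math. J. 99 (1999), Appendix A, Lemma A.5. [AizenmanBurchardDuke1999]
* S. Smirnov, *Critical percolation in the plane*, C. R. Acad. Sci. Paris 333 (2001), §2 (the
  perturbed exploration polygon). [Smirnov2001]
-/

noncomputable section

open Set Metric Literature.Probability.Percolation Literature.Topology.PlaneTopology
open scoped unitInterval

namespace Literature.Probability.LatticeModels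

variable {D : DiscreteDobrushin} {ω : Percolation.BondConfig (Site 2)} {a : MedialVertex}
  {l : List MedialVertex} (hexp : IsMedialExploration D ω (a :: l))

/-! ### Global indexing of the pieces of the perturbed polygon -/

/-- The start point of the `p`-th piece of the perturbed polygon: piece `2i` is the dart piece
`i` (from `pS i` to `pT i`), piece `2i+1` the connector from dart `i` to dart `i+1` (from `pT i`
to `pS (i+1)`). [cite: Smirnov2001, §2] -/
def IsMedialExploration.pieceStart (p : ℕ) : ℂ :=
  if Even p then hexp.pS (p / 2) else hexp.pT (p / 2)

/-- The `p`-th piece of the perturbed polygon, a straight segment. [cite: Smirnov2001, §2] -/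
def IsMedialExploration.pieceSet (p : ℕ) : Set ℂ :=
  segment ℝ (hexp.pieceStart p) (hexp.pieceStart (p + 1))

/-- Start of an even piece. [folklore] -/
theorem IsMedialExploration.pieceStart_two_mul (i : ℕ) : hexp.pieceStart (2 * i) = hexp.pS i := by
  rw [IsMedialExploration.pieceStart, if_pos (even_two_mul i), Nat.mul_div_cancel_left i two_pos]

/-- Start of an odd piece. [folklore] -/
theorem IsMedialExploration.pieceStart_two_mul_add_one (i : ℕ) : hexp.pieceStart (2 * i + 1) = hexp.pT i := by
  rw [IsMedialExploration.pieceStart, if_neg (Nat.not_even_iff_odd.2 (odd_two_mul_add_one i)),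
    show (2 * i + 1) / 2 = i by omega]

/-- Even pieces are dart pieces. [folklore] -/
theorem IsMedialExploration.pieceSet_two_mul (i : ℕ) : hexp.pieceSet (2 * i) = hexp.dartPiece i := by
  rw [IsMedialExploration.pieceSet, hexp.pieceStart_two_mul, hexp.pieceStart_two_mul_add_one]
  rfl

/-- Odd pieces are connectors. [folklore] -/
theorem IsMedialExploration.pieceSet_two_mul_add_one (i : ℕ) :
    hexp.pieceSet (2 * i + 1) = hexp.connPiece (i + 1) := by
  rw [IsMedialExploration.pieceSet, hexp.pieceStart_two_mul_add_one, show 2 * i + 1 + 1 = 2 * (i + 1) by ring,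
    hexp.pieceStart_two_mul, IsMedialExploration.connPiece, Nat.add_sub_cancel]

/-- Every natural number is `2i` or `2i+1`. [folklore] -/
theorem exists_eq_two_mul_or (p : ℕ) : ∃ i, p = 2 * i ∨ p = 2 * i + 1 := by
  rcases Nat.even_or_odd p with ⟨i, hi⟩ | ⟨i, hi⟩
  · exact ⟨i, Or.inl (by omega)⟩
  · exact ⟨i, Or.inr hi⟩

/-- Pieces lie on the perturbed polygon. [folklore] -/
theorem IsMedialExploration.pieceSet_subset_pertTrace {p : ℕ} (hp : (p + 1) / 2 < ((a :: l).zip l).length) :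
    hexp.pieceSet p ⊆ hexp.pertTrace := by
  obtain ⟨i, rfl | rfl⟩ := exists_eq_two_mul_or p
  · rw [hexp.pieceSet_two_mul]
    exact hexp.dartPiece_subset (by omega)
  · rw [hexp.pieceSet_two_mul_add_one]
    exact hexp.connPiece_subset (by omega) (by omega)

/-- **A piece stays within `3δ` of the left vertices of both darts it touches** (`cv (p/2)` and
`cv ((p+1)/2)`). [folklore] -/
theorem IsMedialExploration.pieceSet_subset_closedBall (hδ : 0 < D.δ) {p : ℕ}
    (hp : (p + 1) / 2 < ((a :: l).zip l).length) :
    hexp.pieceSet p ⊆ closedBall (meshPoint D.δ (hexp.cv (p / 2))) (3 * D.δ) ∩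
      closedBall (meshPoint D.δ (hexp.cv ((p + 1) / 2))) (3 * D.δ) := by
  obtain ⟨i, rfl | rfl⟩ := exists_eq_two_mul_or p
  · rw [hexp.pieceSet_two_mul, show 2 * i / 2 = i by omega, show (2 * i + 1) / 2 = i by omega, inter_self]
    exact (hexp.dartPiece_subset_closedBall hδ (by omega)).trans (closedBall_subset_closedBall (by linarith))
  · rw [hexp.pieceSet_two_mul_add_one, show (2 * i + 1) / 2 = i by omega, show (2 * i + 1 + 1) / 2 = i + 1 by omega,
      inter_comm]
    have h := hexp.connPiece_subset_closedBall hδ (i := i + 1) (by omega) (by omega)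
    rwa [Nat.add_sub_cancel] at h

/-- Two points of one piece are within `6δ`. [folklore] -/
theorem IsMedialExploration.dist_le_of_mem_pieceSet (hδ : 0 < D.δ) {p : ℕ}
    (hp : (p + 1) / 2 < ((a :: l).zip l).length) {z w : ℂ} (hz : z ∈ hexp.pieceSet p) (hw : w ∈ hexp.pieceSet p) :
    dist z w ≤ 6 * D.δ := by
  have hz' := ((hexp.pieceSet_subset_closedBall hδ hp) hz).1
  have hw' := ((hexp.pieceSet_subset_closedBall hδ hp) hw).1
  rw [mem_closedBall] at hz' hw'
  linarith [dist_triangle z (meshPoint D.δ (hexp.cv (p / 2))) w, dist_comm w (meshPoint D.δ (hexp.cv (p / 2)))]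

/-- Points of two consecutive pieces are within `6δ` (both pieces are within `3δ` of the vertex
`cv ((p+1)/2)`). [folklore] -/
theorem IsMedialExploration.dist_le_of_mem_pieceSet_succ (hδ : 0 < D.δ) {p : ℕ}
    (hp : (p + 2) / 2 < ((a :: l).zip l).length) {z w : ℂ} (hz : z ∈ hexp.pieceSet p)
    (hw : w ∈ hexp.pieceSet (p + 1)) : dist z w ≤ 6 * D.δ := by
  have hz' := ((hexp.pieceSet_subset_closedBall hδ (p := p) (by omega)) hz).2
  have hw' := ((hexp.pieceSet_subset_closedBall hδ (p := p + 1) (by omega)) hw).1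
  rw [mem_closedBall] at hz' hw'
  linarith [dist_triangle z (meshPoint D.δ (hexp.cv ((p + 1) / 2))) w,
    dist_comm w (meshPoint D.δ (hexp.cv ((p + 1) / 2)))]

/-- Points of two pieces at index distance `≤ 1` are within `6δ`. [folklore] -/
theorem IsMedialExploration.dist_le_of_mem_pieceSet_near (hδ : 0 < D.δ) {p p' : ℕ}
    (hp : (p + 2) / 2 < ((a :: l).zip l).length) (hp' : (p' + 2) / 2 < ((a :: l).zip l).length)
    (h1 : p ≤ p' + 1) (h2 : p' ≤ p + 1) {z w : ℂ} (hz : z ∈ hexp.pieceSet p) (hw : w ∈ hexp.pieceSet p') :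
    dist z w ≤ 6 * D.δ := by
  rcases Nat.lt_trichotomy p p' with h | rfl | h
  · obtain rfl : p' = p + 1 := by omega
    exact hexp.dist_le_of_mem_pieceSet_succ hδ hp hz hw
  · exact hexp.dist_le_of_mem_pieceSet hδ (by omega) hz hw
  · obtain rfl : p = p' + 1 := by omega
    rw [dist_comm]
    exact hexp.dist_le_of_mem_pieceSet_succ hδ hp' hw hz

/-- **Non-consecutive distinct pieces are disjoint** (the perturbed polygon is simple,
`MedialPolygonSimple`). [cite: Smirnov2001, §2] -/
theorem IsMedialExploration.pieceSet_disjoint (hδ : 0 < D.δ) {p p' : ℕ} (hpp' : p + 2 ≤ p')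
    (hp' : (p' + 1) / 2 < ((a :: l).zip l).length) : Disjoint (hexp.pieceSet p) (hexp.pieceSet p') := by
  have hn := hp'
  obtain ⟨i, rfl | rfl⟩ := exists_eq_two_mul_or p <;> obtain ⟨j, rfl | rfl⟩ := exists_eq_two_mul_or p'
  · rw [hexp.pieceSet_two_mul, hexp.pieceSet_two_mul]
    exact hexp.disjoint_dartPiece hδ (by omega) (by omega) (by omega)
  · rw [hexp.pieceSet_two_mul, hexp.pieceSet_two_mul_add_one, Set.disjoint_iff_inter_eq_empty]
    by_contra h
    have := hexp.eq_or_eq_of_dartPiece_inter_connPiece hδ (i := i) (j := j + 1) (by omega) (by omega) (by omega)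
      (Set.nonempty_iff_ne_empty.2 h)
    omega
  · rw [hexp.pieceSet_two_mul_add_one, hexp.pieceSet_two_mul, Set.disjoint_iff_inter_eq_empty]
    by_contra h
    have := hexp.eq_or_eq_of_dartPiece_inter_connPiece hδ (i := j) (j := i + 1) (by omega) (by omega) (by omega)
      (by rw [Set.inter_comm]; exact Set.nonempty_iff_ne_empty.2 h)
    omega
  · rw [hexp.pieceSet_two_mul_add_one, hexp.pieceSet_two_mul_add_one, Set.disjoint_iff_inter_eq_empty]
    by_contra h
    have := hexp.eq_of_connPiece_inter_connPiece hδ (i := i + 1) (j := j + 1) (by omega) (by omega) (by omega)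
      (by omega) (Set.nonempty_iff_ne_empty.2 h)
    omega

/-- Pieces are closed sets. [folklore] -/
theorem IsMedialExploration.isClosed_pieceSet (p : ℕ) : IsClosed (hexp.pieceSet p) := by
  rw [IsMedialExploration.pieceSet, ← Path.range_segment]
  exact (isCompact_range (Path.segment _ _).continuous).isClosed

include hexp in
/-- The number of darts is positive and `tIdx` is a valid dart index. [folklore] -/
theorem IsMedialExploration.tIdx_lt' (u : I) : tIdx l u < ((a :: l).zip l).length := by
  have hl : l ≠ [] := by
    intro h; subst h; exact hexp.head_ne_getLast rfl
  have : 0 < l.length := List.length_pos_iff.2 hl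
  rw [IsMedialExploration.length_zip]; unfold tIdx; omega

/-- **The medial polyline is within `δ` of the left vertex of its current dart.**
[cite: Smirnov2001, §2] -/
theorem IsMedialExploration.dist_polyline_cv_le' (hδ : 0 < D.δ) (u : I) :
    dist (polyline ((a :: l).map (medialPoint D.δ)) u) (meshPoint D.δ (hexp.cv (tIdx l u))) ≤ D.δ :=
  hexp.dist_polyline_meshPoint_le hδ.le (fun _ hi => hexp.isCorner hi)
    (fun _ hi => (hexp.corner_spec hi).2.2.1) (fun _ hi => (hexp.corner_spec hi).2.2.2) u

/-! ### The middle dart and the chain of a tight stretch of pieces -/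

/-- A piece carrying a point at distance `> 6δ` in modulus-about-`x` from a point of the piece
`p'` is at index distance `≥ 2` from `p'`. [folklore] -/
theorem IsMedialExploration.two_le_dist_index (hδ : 0 < D.δ) {p p' : ℕ} {x z z' : ℂ}
    (hp : (p + 2) / 2 < ((a :: l).zip l).length) (hp' : (p' + 2) / 2 < ((a :: l).zip l).length)
    (hz : z ∈ hexp.pieceSet p) (hz' : z' ∈ hexp.pieceSet p') (hfar : 6 * D.δ < |dist z x - dist z' x|) :
    p + 2 ≤ p' ∨ p' + 2 ≤ p := by
  by_contra h
  push Not at h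
  have hd := hexp.dist_le_of_mem_pieceSet_near hδ hp hp' (by omega) (by omega) hz hz'
  have h1 := abs_dist_sub_le z z' x
  linarith

/-- **The left vertex of the dart after the piece `p` is within `4δ` of every point of `p`**
(`cv (p/2 + 1)`; for a connector this is the dart it leads to, for a dart piece the next dart,
whose vertex is within `δ`). [folklore] -/
theorem IsMedialExploration.dist_cv_succ_le_of_mem_pieceSet (hδ : 0 < D.δ) {p : ℕ}
    (hp : p / 2 + 1 < ((a :: l).zip l).length) {z : ℂ} (hz : z ∈ hexp.pieceSet p) :
    dist (meshPoint D.δ (hexp.cv (p / 2 + 1))) z ≤ 4 * D.δ := by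
  have hz' := ((hexp.pieceSet_subset_closedBall hδ (p := p) (by omega)) hz).2
  rw [mem_closedBall] at hz'
  obtain ⟨i, rfl | rfl⟩ := exists_eq_two_mul_or p
  · rw [show (2 * i + 1) / 2 = i by omega] at hz'
    rw [show 2 * i / 2 = i by omega]
    have h := hexp.dist_cv_cv_le hδ (i := i + 1) (by omega) (by omega)
    rw [Nat.add_sub_cancel] at h
    linarith [dist_triangle (meshPoint D.δ (hexp.cv (i + 1))) (meshPoint D.δ (hexp.cv i)) z,
      dist_comm (meshPoint D.δ (hexp.cv i)) (meshPoint D.δ (hexp.cv (i + 1))), dist_comm z (meshPoint D.δ (hexp.cv i))]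
  · rw [show (2 * i + 1 + 1) / 2 = i + 1 by omega] at hz'
    rw [show (2 * i + 1) / 2 + 1 = i + 1 by omega, dist_comm]
    linarith

/-- **The left vertex of the dart before the piece `p` is within `4δ` of every point of `p`**
(`cv ((p+1)/2 - 1)`). [folklore] -/
theorem IsMedialExploration.dist_cv_pred_le_of_mem_pieceSet (hδ : 0 < D.δ) {p : ℕ} (hp1 : 2 ≤ p)
    (hp : (p + 1) / 2 < ((a :: l).zip l).length) {z : ℂ} (hz : z ∈ hexp.pieceSet p) :
    dist (meshPoint D.δ (hexp.cv ((p + 1) / 2 - 1))) z ≤ 4 * D.δ := by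
  have hz' := ((hexp.pieceSet_subset_closedBall hδ hp) hz).1
  rw [mem_closedBall] at hz'
  obtain ⟨i, rfl | rfl⟩ := exists_eq_two_mul_or p
  · rw [show 2 * i / 2 = i by omega] at hz'
    rw [show (2 * i + 1) / 2 - 1 = i - 1 by omega]
    have h := hexp.dist_cv_cv_le hδ (i := i) (by omega) (by omega)
    linarith [dist_triangle (meshPoint D.δ (hexp.cv (i - 1))) (meshPoint D.δ (hexp.cv i)) z,
      dist_comm z (meshPoint D.δ (hexp.cv i))]
  · rw [show (2 * i + 1) / 2 = i by omega] at hz'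
    rw [show (2 * i + 1 + 1) / 2 - 1 = i by omega, dist_comm]
    linarith

/-- **From a tight stretch of pieces to the middle dart and the chain.** Let `pl < ph` be piece
indices such that the pieces strictly between carry only points at distance in `(r₁, r₂)` from
`x`, the pieces `pl` and `ph` carry points `zl`, `zh` at distances `{r₁, r₂}` (in some order),
and some piece `p₀ ∈ [pl, ph]` carries a point at distance `(r₁ + r₂)/2`, where
`r₁ + 40δ ≤ r₂`. Then the dart `m = p₀ / 2` has its piece strictly inside the stretch, and the
darts `i' = pl/2 + 1 ≤ m ≤ j' = (ph+1)/2 - 1` have their pieces strictly inside, their left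
vertices at distance in `(r₁ - 2δ, r₂ + 2δ)`, the end ones within `4δ` of the circles of
radii `r₁` and `r₂` (in the same order as `zl`, `zh`). [cite: AizenmanBurchardDuke1999, Appendix A] -/
theorem IsMedialExploration.middle_and_chain (hδ : 0 < D.δ) {x : ℂ} {r₁ r₂ : ℝ} (hr : r₁ + 40 * D.δ ≤ r₂)
    {pl ph p₀ : ℕ} (hph : (ph + 2) / 2 < ((a :: l).zip l).length) (hp₀l : pl ≤ p₀) (hp₀h : p₀ ≤ ph)
    (hinner : ∀ p, pl < p → p < ph → ∀ z ∈ hexp.pieceSet p, r₁ < dist z x ∧ dist z x < r₂)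
    {zl zh z₀ : ℂ} (hzl : zl ∈ hexp.pieceSet pl) (hzh : zh ∈ hexp.pieceSet ph) (hz₀ : z₀ ∈ hexp.pieceSet p₀)
    (hz₀d : dist z₀ x = (r₁ + r₂) / 2)
    (hends : (dist zl x = r₁ ∧ dist zh x = r₂) ∨ (dist zl x = r₂ ∧ dist zh x = r₁)) :
    pl < 2 * (p₀ / 2) ∧ 2 * (p₀ / 2) < ph ∧ pl / 2 + 1 ≤ p₀ / 2 ∧ p₀ / 2 ≤ (ph + 1) / 2 - 1 ∧
      (∀ i, pl / 2 + 1 ≤ i → i ≤ (ph + 1) / 2 - 1 →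
        pl < 2 * i ∧ 2 * i < ph ∧
        r₁ - 2 * D.δ < dist (meshPoint D.δ (hexp.cv i)) x ∧ dist (meshPoint D.δ (hexp.cv i)) x < r₂ + 2 * D.δ) ∧
      ((dist (meshPoint D.δ (hexp.cv (pl / 2 + 1))) x ≤ r₁ + 4 * D.δ ∧
          r₂ - 4 * D.δ ≤ dist (meshPoint D.δ (hexp.cv ((ph + 1) / 2 - 1))) x) ∨
        (r₂ - 4 * D.δ ≤ dist (meshPoint D.δ (hexp.cv (pl / 2 + 1))) x ∧
          dist (meshPoint D.δ (hexp.cv ((ph + 1) / 2 - 1))) x ≤ r₁ + 4 * D.δ)) := by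
  -- the middle piece is at index distance `≥ 2` from both ends
  have hfarl : 6 * D.δ < |dist z₀ x - dist zl x| := by
    rcases hends with ⟨h, -⟩ | ⟨h, -⟩ <;> rw [hz₀d, h]
    · rw [abs_of_pos (by linarith)]; linarith
    · rw [abs_of_neg (by linarith)]; linarith
  have hfarh : 6 * D.δ < |dist z₀ x - dist zh x| := by
    rcases hends with ⟨-, h⟩ | ⟨-, h⟩ <;> rw [hz₀d, h]
    · rw [abs_of_neg (by linarith)]; linarith
    · rw [abs_of_pos (by linarith)]; linarith
  have h1 := hexp.two_le_dist_index hδ (p := p₀) (p' := pl) (by omega) (by omega) hz₀ hzl hfarl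
  have h2 := hexp.two_le_dist_index hδ (p := p₀) (p' := ph) (by omega) (by omega) hz₀ hzh hfarh
  have hl2 : pl + 2 ≤ p₀ := by omega
  have hh2 : p₀ + 2 ≤ ph := by omega
  refine ⟨by omega, by omega, by omega, by omega, fun i hi1 hi2 ↦ ?_, ?_⟩
  · have hlt1 : pl < 2 * i := by omega
    have hlt2 : 2 * i < ph := by omega
    have hin := hinner (2 * i) hlt1 hlt2 (hexp.pS i) (by rw [hexp.pieceSet_two_mul]; exact left_mem_segment _ _ _)
    have hd := (hexp.dist_pS_le hδ (i := i) (by omega)).1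
    refine ⟨hlt1, hlt2, ?_, ?_⟩
    · linarith [dist_triangle (hexp.pS i) (meshPoint D.δ (hexp.cv i)) x]
    · linarith [dist_triangle (meshPoint D.δ (hexp.cv i)) (hexp.pS i) x, dist_comm (meshPoint D.δ (hexp.cv i)) (hexp.pS i)]
  · have hdl := hexp.dist_cv_succ_le_of_mem_pieceSet hδ (p := pl) (by omega) hzl
    have hdh := hexp.dist_cv_pred_le_of_mem_pieceSet hδ (p := ph) (by omega) (by omega) hzh
    rcases hends with ⟨h1, h2⟩ | ⟨h1, h2⟩
    · left
      constructor
      · linarith [dist_triangle (meshPoint D.δ (hexp.cv (pl / 2 + 1))) zl x]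
      · linarith [dist_triangle zh (meshPoint D.δ (hexp.cv ((ph + 1) / 2 - 1))) x,
          dist_comm zh (meshPoint D.δ (hexp.cv ((ph + 1) / 2 - 1)))]
    · right
      constructor
      · linarith [dist_triangle zl (meshPoint D.δ (hexp.cv (pl / 2 + 1))) x,
          dist_comm zl (meshPoint D.δ (hexp.cv (pl / 2 + 1)))]
      · linarith [dist_triangle (meshPoint D.δ (hexp.cv ((ph + 1) / 2 - 1))) zh x]

/-! ### One traversal: the tight arc, the middle dart and the chain -/

/-- **The tight arc of a traversal.** Let the medial polyline of the exploration traverse the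
shell `D(x; ρ, R)` between the times `s ≤ t`, and let `ρ + 3δ < q₁`, `q₂ + 3δ < R`,
`q₁ + 7δ ≤ r₁`, `r₂ + 7δ ≤ q₂`, `r₁ + 40δ ≤ r₂`. Then the pieces of the perturbed polygon with
indices in some range `[pl, ph] ⊆ [2·tIdx s, 2·tIdx t - 1]` carry a path `T` from a point `E` of
the circle of radius `q₁` to a point `F` of the circle of radius `q₂`, inside the closed annulus
and meeting each circle only at the corresponding endpoint; a dart `m` whose piece lies on `T`;
and darts `i' ≤ m ≤ j'` in `[tIdx s, tIdx t]` whose left vertices are at distance in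
`(r₁ - 2δ, r₂ + 2δ)` from `x`, the first within `r₁ + 4δ` and the last beyond `r₂ - 4δ` or
conversely. (Aizenman–Burchard 1999, App. A: the crossing segment of a traversal and the path
along its side.) [cite: AizenmanBurchardDuke1999, Appendix A, Lemma A.5] -/
theorem IsMedialExploration.exists_traversal_arc (hδ : 0 < D.δ) {x : ℂ} {ρ R q₁ q₂ r₁ r₂ : ℝ}
    (hq₁ : ρ + 3 * D.δ < q₁) (hq₂ : q₂ + 3 * D.δ < R) (hr₁ : q₁ + 7 * D.δ ≤ r₁) (hr₂ : r₂ + 7 * D.δ ≤ q₂)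
    (hr : r₁ + 40 * D.δ ≤ r₂) {s t : I}
    (hst : (⟨polyline ((a :: l).map (medialPoint D.δ))⟩ : RandomPlanarGeometry.Curve ℂ).IsTraversal x ρ R s t) :
    ∃ (pl ph : ℕ) (E F : ℂ) (T : Path E F) (m i' j' : ℕ),
      2 * tIdx l s ≤ pl ∧ pl < ph ∧ ph + 2 ≤ 2 * tIdx l t + 1 ∧
      dist E x = q₁ ∧ dist F x = q₂ ∧
      range T ⊆ (⋃ p ∈ Finset.Icc pl ph, hexp.pieceSet p) ∧ range T ⊆ hexp.pertTrace ∧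
      (∀ z ∈ range T, q₁ ≤ dist z x ∧ dist z x ≤ q₂ ∧ (dist z x = q₁ → z = E) ∧ (dist z x = q₂ → z = F)) ∧
      hexp.dartPiece m ⊆ range T ∧
      i' ≤ m ∧ m ≤ j' ∧ tIdx l s ≤ i' ∧ j' ≤ tIdx l t ∧
      (∀ i, i' ≤ i → i ≤ j' →
        r₁ - 2 * D.δ < dist (meshPoint D.δ (hexp.cv i)) x ∧ dist (meshPoint D.δ (hexp.cv i)) x < r₂ + 2 * D.δ) ∧
      ((dist (meshPoint D.δ (hexp.cv i')) x ≤ r₁ + 4 * D.δ ∧ r₂ - 4 * D.δ ≤ dist (meshPoint D.δ (hexp.cv j')) x) ∨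
        (r₂ - 4 * D.δ ≤ dist (meshPoint D.δ (hexp.cv i')) x ∧ dist (meshPoint D.δ (hexp.cv j')) x ≤ r₁ + 4 * D.δ)) := by
  set n := ((a :: l).zip l).length with hn
  set γ : I → ℂ := fun u ↦ polyline ((a :: l).map (medialPoint D.δ)) u with hγ
  have hcurve : ∀ u, (⟨polyline ((a :: l).map (medialPoint D.δ))⟩ : RandomPlanarGeometry.Curve ℂ) u = γ u :=
    fun u ↦ rfl
  -- the start point of the dart at time `u` is within `3δ` of the polyline at time `u`
  have hpS : ∀ u, dist (hexp.pS (tIdx l u)) (γ u) ≤ 3 * D.δ := by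
    intro u
    have h1 := hexp.dist_polyline_cv_le' hδ u
    have h2 := (hexp.dist_pS_le hδ (hexp.tIdx_lt' u)).1
    linarith [dist_triangle (hexp.pS (tIdx l u)) (meshPoint D.δ (hexp.cv (tIdx l u))) (γ u),
      dist_comm (γ u) (meshPoint D.δ (hexp.cv (tIdx l u)))]
  obtain ⟨hst0, hends⟩ := hst
  simp only [hcurve] at hends
  have htlt : tIdx l t < n := hexp.tIdx_lt' t
  -- the traversal uses at least two darts
  have hlt : tIdx l s < tIdx l t := by
    refine lt_of_le_of_ne (tIdx_mono l hst0) fun h ↦ ?_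
    have h1 := hpS s; have h2 := hpS t
    rw [h] at h1
    have hd : dist (γ s) (γ t) ≤ 6 * D.δ := by
      linarith [dist_triangle (γ s) (hexp.pS (tIdx l t)) (γ t), dist_comm (γ s) (hexp.pS (tIdx l t))]
    rcases hends with ⟨hs1, ht1⟩ | ⟨hs1, ht1⟩
    · linarith [dist_triangle (γ t) (γ s) x, dist_comm (γ t) (γ s)]
    · linarith [dist_triangle (γ s) (γ t) x]
  set ps := 2 * tIdx l s with hps
  set pe := 2 * tIdx l t - 1 with hpe
  have hpse : ps ≤ pe := by omega
  have hpe1 : pe + 1 = 2 * tIdx l t := by omega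
  have hdiam : ∀ {c : ℝ}, 6 * D.δ < c → ∀ p, ps ≤ p → p ≤ pe → ∀ z ∈ segment ℝ (hexp.pieceStart p) (hexp.pieceStart (p + 1)),
      ∀ w ∈ segment ℝ (hexp.pieceStart p) (hexp.pieceStart (p + 1)), dist z w < c := by
    intro c hc p _ hp2 z hz w hw
    exact (hexp.dist_le_of_mem_pieceSet hδ (p := p) (by omega) hz hw).trans_lt hc
  have hq : 6 * D.δ < q₂ - q₁ := by linarith
  have hr' : 6 * D.δ < r₂ - r₁ := by linarith
  have hps_pt : hexp.pieceStart ps = hexp.pS (tIdx l s) := hexp.pieceStart_two_mul _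
  have hpe_pt : hexp.pieceStart (pe + 1) = hexp.pS (tIdx l t) := by rw [hpe1]; exact hexp.pieceStart_two_mul _
  -- assembling the conclusion from the two levels of tight stretches (direction-free)
  have assemble : ∀ (pl ph : ℕ) (E F : ℂ) (T : Path E F) (pl' ph' : ℕ) (E' F' : ℂ) (T' : Path E' F'),
      ps ≤ pl → pl < pl' → pl' < ph' → ph' < ph → ph ≤ pe →
      dist E x = q₁ → dist F x = q₂ →
      range T ⊆ (⋃ p ∈ Finset.Icc pl ph, hexp.pieceSet p) →
      (∀ z ∈ range T, q₁ ≤ dist z x ∧ dist z x ≤ q₂ ∧ (dist z x = q₁ → z = E) ∧ (dist z x = q₂ → z = F)) →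
      (∀ p, pl < p → p < ph → hexp.pieceSet p ⊆ range T) →
      ((dist E' x = r₁ ∧ dist F' x = r₂) ∨ (dist E' x = r₂ ∧ dist F' x = r₁)) →
      E' ∈ hexp.pieceSet pl' → F' ∈ hexp.pieceSet ph' →
      range T' ⊆ (⋃ p ∈ Finset.Icc pl' ph', hexp.pieceSet p) →
      (∀ p, pl' < p → p < ph' → ∀ z ∈ hexp.pieceSet p, r₁ < dist z x ∧ dist z x < r₂) →
      ∃ (pl ph : ℕ) (E F : ℂ) (T : Path E F) (m i' j' : ℕ),
      2 * tIdx l s ≤ pl ∧ pl < ph ∧ ph + 2 ≤ 2 * tIdx l t + 1 ∧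
      dist E x = q₁ ∧ dist F x = q₂ ∧
      range T ⊆ (⋃ p ∈ Finset.Icc pl ph, hexp.pieceSet p) ∧ range T ⊆ hexp.pertTrace ∧
      (∀ z ∈ range T, q₁ ≤ dist z x ∧ dist z x ≤ q₂ ∧ (dist z x = q₁ → z = E) ∧ (dist z x = q₂ → z = F)) ∧
      hexp.dartPiece m ⊆ range T ∧
      i' ≤ m ∧ m ≤ j' ∧ tIdx l s ≤ i' ∧ j' ≤ tIdx l t ∧
      (∀ i, i' ≤ i → i ≤ j' →
        r₁ - 2 * D.δ < dist (meshPoint D.δ (hexp.cv i)) x ∧ dist (meshPoint D.δ (hexp.cv i)) x < r₂ + 2 * D.δ) ∧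
      ((dist (meshPoint D.δ (hexp.cv i')) x ≤ r₁ + 4 * D.δ ∧ r₂ - 4 * D.δ ≤ dist (meshPoint D.δ (hexp.cv j')) x) ∨
        (r₂ - 4 * D.δ ≤ dist (meshPoint D.δ (hexp.cv i')) x ∧ dist (meshPoint D.δ (hexp.cv j')) x ≤ r₁ + 4 * D.δ)) := by
    intro pl ph E F T pl' ph' E' F' T' h1 h2 h3 h4 h5 hEd hFd hsub htight hwhole hends' hE' hF' hsub' hinner
    -- a point of `T'` at the middle distance
    have hT'c : Continuous fun u : I ↦ dist (T' u) x := T'.continuous.dist continuous_const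
    have hmid : (r₁ + r₂) / 2 ∈ Icc (dist (T' 0) x) (dist (T' 1) x) ∨ (r₁ + r₂) / 2 ∈ Icc (dist (T' 1) x) (dist (T' 0) x) := by
      rw [T'.source, T'.target]
      rcases hends' with ⟨h1, h2⟩ | ⟨h1, h2⟩ <;> rw [h1, h2]
      · left; constructor <;> linarith
      · right; constructor <;> linarith
    obtain ⟨u₀, hu₀⟩ : ∃ u₀ : I, dist (T' u₀) x = (r₁ + r₂) / 2 := by
      rcases hmid with h | h
      · exact intermediate_value_univ 0 1 hT'c h
      · exact intermediate_value_univ 1 0 hT'c h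
    have hz₀ : T' u₀ ∈ ⋃ p ∈ Finset.Icc pl' ph', hexp.pieceSet p := hsub' ⟨u₀, rfl⟩
    obtain ⟨p₀, hp₀, hz₀p⟩ := mem_iUnion₂.1 hz₀
    rw [Finset.mem_Icc] at hp₀
    obtain ⟨hm1, hm2, hm3, hm4, hchain, hcends⟩ := hexp.middle_and_chain hδ hr (pl := pl') (ph := ph') (p₀ := p₀)
      (by omega) hp₀.1 hp₀.2 hinner hE' hF' hz₀p hu₀ hends'
    refine ⟨pl, ph, E, F, T, p₀ / 2, pl' / 2 + 1, (ph' + 1) / 2 - 1, h1, by omega, by omega, hEd, hFd, hsub, ?_,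
      htight, ?_, hm3, hm4, by omega, by omega, fun i hi1 hi2 ↦ ((hchain i hi1 hi2).2.2), hcends⟩
    · refine hsub.trans fun z hz ↦ ?_
      obtain ⟨p, hp, hz⟩ := mem_iUnion₂.1 hz
      rw [Finset.mem_Icc] at hp
      exact hexp.pieceSet_subset_pertTrace (by omega) hz
    · rw [← hexp.pieceSet_two_mul]
      exact hwhole _ (by omega) (by omega)
  rcases hends with ⟨hs1, ht1⟩ | ⟨hs1, ht1⟩
  · /- inward-to-outward traversal -/
    have hstart : dist (hexp.pieceStart ps) x < q₁ := by
      rw [hps_pt]; linarith [dist_triangle (hexp.pS (tIdx l s)) (γ s) x, hpS s]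
    have hend : q₂ < dist (hexp.pieceStart (pe + 1)) x := by
      rw [hpe_pt]; linarith [dist_triangle (γ t) (hexp.pS (tIdx l t)) x, hpS t, dist_comm (γ t) (hexp.pS (tIdx l t))]
    obtain ⟨p₁, p₂, E, F, T, hp₁, hp₁₂, hp₂, hE, hF, hEd, hFd, hrange, hsub, htight, hlt₂, hgt₁⟩ :=
      exists_tight_polyline hexp.pieceStart x hpse (hdiam hq) hstart hend
    -- `p₁ + 2 ≤ p₂`
    have hfar : 6 * D.δ < |dist E x - dist F x| := by rw [hEd, hFd, abs_of_neg (by linarith)]; linarith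
    have hgap : p₁ + 2 ≤ p₂ := by
      rcases hexp.two_le_dist_index hδ (p := p₁) (p' := p₂) (by omega) (by omega) hE hF hfar with h | h <;> omega
    -- second level on the whole pieces `p₁ < p < p₂`
    have hstart' : dist (hexp.pieceStart (p₁ + 1)) x < r₁ := by
      have h := hexp.dist_le_of_mem_pieceSet hδ (p := p₁) (by omega) (right_mem_segment _ _ _) hE
      linarith [dist_triangle (hexp.pieceStart (p₁ + 1)) E x]
    have hend' : r₂ < dist (hexp.pieceStart (p₂ - 1 + 1)) x := by
      rw [show p₂ - 1 + 1 = p₂ by omega]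
      have h := hexp.dist_le_of_mem_pieceSet hδ (p := p₂) (by omega) (left_mem_segment _ _ _) hF
      linarith [dist_triangle F (hexp.pieceStart p₂) x, dist_comm F (hexp.pieceStart p₂)]
    obtain ⟨p₁', p₂', E', F', T', hp₁', hp₁₂', hp₂', hE', hF', hEd', hFd', -, hsub', -, hlt₂', hgt₁'⟩ :=
      exists_tight_polyline hexp.pieceStart x (ps := p₁ + 1) (pe := p₂ - 1) (by omega) (fun p h1 h2 ↦ hdiam hr' p (by omega) (by omega)) hstart' hend'
    refine assemble p₁ p₂ E F T p₁' p₂' E' F' T' hp₁ (by omega) hp₁₂' (by omega) hp₂ hEd hFd hsub htight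
      (fun p h1 h2 ↦ ?_) (Or.inl ⟨hEd', hFd'⟩) hE' hF' hsub' (fun p h1 h2 z hz ↦ ⟨hgt₁' p h1 h2.le z hz, hlt₂' p (by omega) h2 z hz⟩)
    rw [hrange]
    intro z hz
    exact Or.inl (Or.inr (mem_iUnion₂.2 ⟨p, Finset.mem_Ioo.2 ⟨h1, h2⟩, hz⟩))
  · /- outward-to-inward traversal -/
    have hstart : q₂ < dist (hexp.pieceStart ps) x := by
      rw [hps_pt]; linarith [dist_triangle (γ s) (hexp.pS (tIdx l s)) x, hpS s, dist_comm (γ s) (hexp.pS (tIdx l s))]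
    have hend : dist (hexp.pieceStart (pe + 1)) x < q₁ := by
      rw [hpe_pt]; linarith [dist_triangle (hexp.pS (tIdx l t)) (γ t) x, hpS t]
    obtain ⟨p₁, p₂, E, F, T, hp₂, hp₂₁, hp₁, hE, hF, hEd, hFd, hrange, hsub, htight, hlt₂, hgt₁⟩ :=
      exists_tight_polyline' hexp.pieceStart x hpse (hdiam hq) hstart hend
    have hfar : 6 * D.δ < |dist E x - dist F x| := by rw [hEd, hFd, abs_of_neg (by linarith)]; linarith
    have hgap : p₂ + 2 ≤ p₁ := by
      rcases hexp.two_le_dist_index hδ (p := p₁) (p' := p₂) (by omega) (by omega) hE hF hfar with h | h <;> omega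
    have hstart' : r₂ < dist (hexp.pieceStart (p₂ + 1)) x := by
      have h := hexp.dist_le_of_mem_pieceSet hδ (p := p₂) (by omega) (right_mem_segment _ _ _) hF
      linarith [dist_triangle F (hexp.pieceStart (p₂ + 1)) x, dist_comm F (hexp.pieceStart (p₂ + 1))]
    have hend' : dist (hexp.pieceStart (p₁ - 1 + 1)) x < r₁ := by
      rw [show p₁ - 1 + 1 = p₁ by omega]
      have h := hexp.dist_le_of_mem_pieceSet hδ (p := p₁) (by omega) (left_mem_segment _ _ _) hE
      linarith [dist_triangle (hexp.pieceStart p₁) E x]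
    obtain ⟨p₁', p₂', E', F', T', hp₂', hp₂₁', hp₁', hE', hF', hEd', hFd', -, hsub', -, hlt₂', hgt₁'⟩ :=
      exists_tight_polyline' hexp.pieceStart x (ps := p₂ + 1) (pe := p₁ - 1) (by omega) (fun p h1 h2 ↦ hdiam hr' p (by omega) (by omega)) hstart' hend'
    -- here `F'` (distance `r₂`) is on the earlier piece `p₂'`, `E'` (distance `r₁`) on the later piece `p₁'`
    refine assemble p₂ p₁ E F T p₂' p₁' F' E' T'.symm hp₂ (by omega) hp₂₁' (by omega) hp₁ hEd hFd hsub htight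
      (fun p h1 h2 ↦ ?_) (Or.inr ⟨hFd', hEd'⟩) hF' hE' (by rw [Path.symm_range]; exact hsub')
      (fun p h1 h2 z hz ↦ ⟨hgt₁' p h1.le h2 z hz, hlt₂' p h1 (by omega) z hz⟩)
    rw [hrange]
    intro z hz
    exact Or.inl (Or.inr (mem_iUnion₂.2 ⟨p, Finset.mem_Ioo.2 ⟨h1, h2⟩, hz⟩))

end Literature.Probability.LatticeModels

end
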